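import Summits.QuantumFields.YangMills.Theorems.BalabanUVNodesN21RecentredDilationTransversal
import Summits.QuantumFields.YangMills.Theorems.BalabanUVNodesN21LowCentreNonCollapse

/-!
# N21 (NE7c) · (M1) on the cut law about a LOW centre: part 28's re-centred END with the non-collapse binder
# DISCHARGED by convexity (lens ROW P″ corollary)

R134 seat pub-ymgap-dag-n21-d (g8), node N21 = NE7c (single-run shell-weight bound, NOT PRINTED in [Bałaban 1983–89],
NOT proved), lane K3⁷ `SpineGivenEndpointR13SepCoPH` (stmt-QuantumFields-20544, `--kind proof --supports … --as helper`).
Part 31 of the comparison series; consumes part 28 (`…N21RecentredDilationTransversal`, lens ROW P: P2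
`slotAntiConcentration_restrict_of_recentredDilation`) and part 30 (`…N21LowCentreNonCollapse`, lens ROW P″:
`hmono_of_lowCentre`).  The statement is the «8-line corollary» the lens's v28.0 ROW P″ names; this seat types it.

WHAT THIS FILE IS.  ★ `slotAntiConcentration_restrict_of_lowCentre`: in the product frame `X × (κ → ℝ)` (exterior
point, block chart) with the density `g p = 𝟙_{K p.1}(p.2)·e^{−φ_{p.1}(p.2)}` — kept CONVEX cuts `K z` and a CONVEX
block potential `φ_z` — and a measurable centre `m z ∈ K z` that is LOW seen from the shell ∩ cut
(`φ_z(m z) ≤ φ_z(m z + l₀(w − m z))`, `l₀ = 1 − 1∕(#κ+1)`), part 28's `hmono` binder is DISCHARGED by part 30's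
`hmono_of_lowCentre`; the remaining binders are the envelope, radial transversality `κ₀` and the odds `Q`:
`SlotAntiConcentration (ν|({U<θ} ∩ C)) U θ ρ (3(#κ+1)(1+Q)∕(κ₀(1−ρ)))`.

HONEST FRAMING.  [textbook]; 0 def, 0 sorry; convexity of the kept cuts ∕ block potential, lowness of the centre,
envelope, transversality and odds remain displayed HYPOTHESES; nothing of Bałaban's asserted; NE7c NOT PRINTED ∕ NOT
proved; N21 NOT discharged; counts unmoved (typed 28∕28 · discharged 5∕27); count-neutral; one finite 𝕋⁴ at fixed ε
— nothing about ℝ⁴ ∕ OS ∕ mass gap ∕ Clay.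
-/

open MeasureTheory Set Function
open scoped ENNReal

namespace Summit.QuantumFields.YangMills.Theorems.N21LowCentreDilation

open Literature.MathematicalPhysics.QuantumFieldTheory.Balaban1983to89.T4ShellMeasure (SlotAntiConcentration)
open Summit.QuantumFields.YangMills.Theorems.N21RecentredDilationTransversal
  (slotAntiConcentration_restrict_of_recentredDilation)
open Summit.QuantumFields.YangMills.Theorems.N21LowCentreNonCollapse (hmono_of_lowCentre)

variable {X : Type*} [MeasurableSpace X] {κ : Type*} [Fintype κ]

/-- ★ **(M1) ON THE CUT LAW ABOUT A LOW CENTRE** (lens v28.0 ROW P″ corollary): part 28's P2 with the density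
`𝟙_{K p.1}(p.2)·e^{−φ_{p.1}(p.2)}` and its non-collapse binder discharged by convexity + lowness of the centre
(part 30 `hmono_of_lowCentre` at `l₀ = 1 − 1∕(#κ+1)`). [textbook] -/
theorem slotAntiConcentration_restrict_of_lowCentre [Nonempty κ] (ζ : Measure X) [SFinite ζ]
    {m : X → (κ → ℝ)} (hm : Measurable m) (K : X → Set (κ → ℝ)) (φ : X → (κ → ℝ) → ℝ)
    (hg : Measurable fun p : X × (κ → ℝ) =>
      (K p.1).indicator (fun w => ENNReal.ofReal (Real.exp (-φ p.1 w))) p.2)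
    {U : X × (κ → ℝ) → ℝ} (hUm : Measurable U)
    {C Env : Set (X × (κ → ℝ))} (hC : MeasurableSet C) (hEnv : MeasurableSet Env)
    {θ ρ κ₀ Q : ℝ} (hθ : 0 < θ) (hρ0 : 0 < ρ) (hρ1 : ρ < 1) (hκ : 0 < κ₀) (hQ0 : 0 ≤ Q)
    (hK : ∀ z, Convex ℝ (K z)) (hφ : ∀ z, ConvexOn ℝ (K z) (φ z)) (hmK : ∀ z, m z ∈ K z)
    (hlow : ∀ p : X × (κ → ℝ), θ * (1 - ρ) ≤ U p → U p < θ → p ∈ C → p.2 ∈ K p.1 →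
      φ p.1 (m p.1) ≤ φ p.1 (m p.1 + (1 - 1 / ((Fintype.card κ : ℝ) + 1)) • (p.2 - m p.1)))
    (henv : ∀ l ∈ Icc (1 - 1 / ((Fintype.card κ : ℝ) + 1)) 1, ∀ p : X × (κ → ℝ),
      θ * (1 - ρ) ≤ U p → U p < θ → p ∈ C → (p.1, m p.1 + l • (p.2 - m p.1)) ∈ Env)
    (hRT : ∀ p : X × (κ → ℝ), θ * (1 - ρ) ≤ U p → U p < θ → p ∈ C → ∀ s : ℝ, 1 ≤ s →
      θ * (1 - ρ) ≤ U (p.1, m p.1 + s • (p.2 - m p.1)) → U (p.1, m p.1 + s • (p.2 - m p.1)) < θ →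
        (p.1, m p.1 + s • (p.2 - m p.1)) ∈ C →
          U p + κ₀ * (θ * (1 - ρ)) * (s - 1) ≤ U (p.1, m p.1 + s • (p.2 - m p.1)))
    (hQ : ((ζ.prod volume).withDensity fun p : X × (κ → ℝ) =>
        (K p.1).indicator (fun w => ENNReal.ofReal (Real.exp (-φ p.1 w))) p.2) (Env \ ({p | U p < θ} ∩ C))
      ≤ ENNReal.ofReal Q * ((ζ.prod volume).withDensity fun p : X × (κ → ℝ) =>
        (K p.1).indicator (fun w => ENNReal.ofReal (Real.exp (-φ p.1 w))) p.2) ({p | U p < θ} ∩ C)) :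
    SlotAntiConcentration
      ((((ζ.prod volume).withDensity fun p : X × (κ → ℝ) =>
          (K p.1).indicator (fun w => ENNReal.ofReal (Real.exp (-φ p.1 w))) p.2)).restrict ({p | U p < θ} ∩ C))
      U θ ρ (3 * ((Fintype.card κ : ℝ) + 1) * (1 + Q) / (κ₀ * (1 - ρ))) := by
  have hl₀ : 0 < 1 - 1 / ((Fintype.card κ : ℝ) + 1) := by
    have hcard : (1 : ℝ) ≤ (Fintype.card κ : ℝ) := by exact_mod_cast Fintype.card_pos
    have : 1 / ((Fintype.card κ : ℝ) + 1) < 1 := by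
      rw [div_lt_one (by positivity)]
      linarith
    linarith
  exact slotAntiConcentration_restrict_of_recentredDilation ζ hm hg hUm hC hEnv hθ hρ0 hρ1 hκ hQ0 henv
    (hmono_of_lowCentre K φ m U C hK hφ hmK hl₀ hlow) hRT hQ

end Summit.QuantumFields.YangMills.Theorems.N21LowCentreDilation
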